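import Literature.NumberTheory.ComplexMultiplication.FaltingsTateOfCMEllipticProducts
import Summits.HodgeConjecture.HodgeConjecture.Theorems.HCCMUnconditionalShimuraThm18_6Holds
import HarnessLib

/-!
# T5 §6.5 — [Fal83 §5 Kor. 1] for products of powers of two CM elliptic structures, UNCONDITIONALLY

Cell hodgecm-mathlib, fan A, binder hLiu418 (item stmt-HodgeConjecture-24832), sub-skeleton
`Cruxes/HLiu418/Lines/faltings_isogeny.lean` (row VI-1 = the floor binder
`hFal : ∀ {K} [Field K] (A B : AbelianVariety K) ℓ [Fact ℓ.Prime], faltings_tate_bijective A B ℓ`;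
FALTINGS-SPEC §9 witness ledger).  The Literature head
`Literature.NumberTheory.ComplexMultiplication.faltings_tate_bijective_of_isIsogenous_prod_of_distinct_CM_elliptic_of_thm18_6`
proves, granted the named fact `shimura1998_thm18_6` ([Shimura 1998, Thm. 18.6]), that for two CM
elliptic structures `(A₁, ι₁)`, `(A₂, ι₂)` of types `(K₁, Φ₁)`, `(K₂, Φ₂)` over a field `k → ℂ` (the
predicate quantifies over `[NumberField k]`) with `[K_i : ℚ] = 2` and `K₁ ≄ K₂`, every `A`
`k`-isogenous to `A₁ᵃ ⊞ A₂ᵇ`, every `B` `k`-isogenous to `A₁ᶜ ⊞ A₂ᵈ` and every prime `ℓ`, the Tate map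
`ℤ_ℓ ⊗ Hom_k(A, B) → Hom_{Γ_k}(T_ℓ A, T_ℓ B)` is bijective; that fact is a THEOREM of the tree Summits-side
(`Theorems.shimura1998_thm18_6_holds`, row II-1), so here the VI-1 TEXT ITSELF is decided with NO
hypothesis on the additive ⊞/isogeny closure of two CM elliptic structures with different CM fields —
the widest decided family of the floor binder's own text so far (★ `HLiu418FaltingsTateOfCMEllipticPowers`,
★ `HLiu418FaltingsTateOfDistinctCMFields` are the two generators).  Witness rung; no floor change.

HC_CM is proved only modulo the printed citations of the floor until rung 0 closes; this file moves
no floor binder.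
-/

-- mandated namespace `Summit.HodgeConjecture.HodgeConjecture.Theorems` trips `linter.dupNamespace` (single-problem
-- summit); off as in `HCCMUnconditionalShimuraThm18_6Holds.lean`.
set_option linter.dupNamespace false

open CategoryTheory CategoryTheory.Limits NumberField
open scoped NumberField

namespace Summit.HodgeConjecture.HodgeConjecture.Theorems

open Literature.AlgebraicGeometry.Motives
open Literature.NumberTheory.ComplexMultiplication

/-- **[Faltings 1983, §5 Kor. 1] on the ⊞/isogeny closure of two CM elliptic structures with
non-isomorphic CM fields, unconditionally**: for `(A₁, ι₁)` of CM type `(K₁, Φ₁)` and `(A₂, ι₂)` of CM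
type `(K₂, Φ₂)` over a field `k → ℂ` with `[K₁ : ℚ] = [K₂ : ℚ] = 2` and `IsEmpty (K₁ ≃ₐ[ℚ] K₂)`, all
`a b c d : ℕ`, every `A` `k`-isogenous to `(⨁_{Fin a} A₁) ⊞ (⨁_{Fin b} A₂)`, every `B` `k`-isogenous to
`(⨁_{Fin c} A₁) ⊞ (⨁_{Fin d} A₂)` and every prime `ℓ`, `faltings_tate_bijective A B ℓ` (over number
fields `k`, as the predicate quantifies) — the Literature head fed with the tree's theorem
`shimura1998_thm18_6_holds` ([Shimura 1998, Thm. 18.6], row II-1).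
[cite: Faltings1983Endlichkeit, §5 Korollar 1] [cite: Shimura1998, §13.1 Theorem 1 (ii) and §18.6 Theorem 18.6] -/
theorem faltings_tate_bijective_of_isIsogenous_prod_of_distinct_CM_elliptic :
    ∀ {k : Type} [Field k] [Algebra k ℂ] {K₁ K₂ : Type} [Field K₁] [NumberField K₁]
      [IsCMField K₁] [Field K₂] [NumberField K₂] [IsCMField K₂]
      (Φ₁ : CMType K₁) (A₁ : AbelianVariety k) (ι₁ : 𝓞 K₁ →+* End A₁)
      (Φ₂ : CMType K₂) (A₂ : AbelianVariety k) (ι₂ : 𝓞 K₂ →+* End A₂),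
      IsCMTypeRealisationOver Φ₁ A₁ ι₁ → Module.finrank ℚ K₁ = 2 →
      IsCMTypeRealisationOver Φ₂ A₂ ι₂ → Module.finrank ℚ K₂ = 2 → IsEmpty (K₁ ≃ₐ[ℚ] K₂) →
      ∀ (a b c d : ℕ) (A B : AbelianVariety k),
        AbelianVariety.IsIsogenous ((⨁ fun _ : Fin a => A₁) ⊞ (⨁ fun _ : Fin b => A₂)) A →
        AbelianVariety.IsIsogenous ((⨁ fun _ : Fin c => A₁) ⊞ (⨁ fun _ : Fin d => A₂)) B →
        ∀ (ℓ : ℕ) [Fact ℓ.Prime], faltings_tate_bijective A B ℓ :=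
  Literature.NumberTheory.ComplexMultiplication.faltings_tate_bijective_of_isIsogenous_prod_of_distinct_CM_elliptic_of_thm18_6
    shimura1998_thm18_6_holds

end Summit.HodgeConjecture.HodgeConjecture.Theorems
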